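import Summits.AtomisticToContinuum.FouriersLaw.Theorems.BondHeatUncertaintyExtensiveSnapshotIrreversibilityEnergyWindowExcessAtoms
import Summits.AtomisticToContinuum.FouriersLaw.Theorems.BondHeatUncertaintyExtensiveSnapshotIrreversibilityEnergyWindowExcessTails
import Summits.AtomisticToContinuum.FouriersLaw.Theorems.BondHeatUncertaintyExtensiveSnapshotIrreversibilityEnergyWindowDivergenceHalfExp

/-!
# Crux `ExtensiveSnapshotIrreversibility` (stmt-AtomisticToContinuum-9121), fixed-`N` half `K_fix`:
the RUNGS into USharp and the junctions of record
(node «UniformIntegrabilityLadder»; rungs file)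

(rungs + corollaries file, theorem-side; decomp-a2c lens-1 «grading / quantitative ladder»,
generation 90.)

USharp (`NessOddLogRatioUniformlyIntegrable`, `…ExcessAtoms`) is necessary for `K_fix`; this file
grades the SUFFICIENT conditions for it that the lineage has produced, each now a rung into the
one atom:

* `NessOddLogRatioMomentDecay m a` — MOMENT DECAY: `∫ |ψ|ᵐ dμ_δ ≤ C |δ|ᵃ` for `0 < |δ| < δ₀` and
  every representing `φ` (`ψ = φ − φ∘Θ`).  The pair `(m, a)` is the grading: `a = m` is LINEAR SIZE
  (`ψ_δ = O(δ)` in `Lᵐ(μ_δ)`), `a = −r` is generation 88's A2ₘ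
  (`nessOddLogRatioMoment_of_momentDecay`);
* ★ `nessOddLogRatioUniformlyIntegrable_of_momentDecay` — `m ≥ 1`, `a > 2` ⟹ USharp (Chebyshev;
  the threshold `a = 2` is sharp for the rung);
* ★ `nessOddLogRatioUniformlyIntegrable_of_moment_of_concentration` — A2ₚ ∧ SPC ⟹ USharp
  (`p > 1`; Young on the level set): generation 89's tail pair is a rung, NOT an atom;
* junctions of record: `K_fix ⟸ A0 ∧ ΔSharp ∧ MomentDecay(m, a)`
  (`snapshotKLUpperExpansion_of_momentDecay`), generation 89's
  `K_fix ⟸ A0 ∧ A2ₚ ∧ SPC ∧ ΔSharp` recovered THROUGH USharp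
  (`snapshotKLUpperExpansion_of_concentration'`), and — with generation 89's `A0 ∧ A4 ⟹ ΔSharp` —
  ★★ `snapshotKLUpperExpansion_iff_uniformlyIntegrable`: `A0 ∧ A4 ⊢ (K_fix ⟺ USharp)`: modulo the
  Gibbs reweighting (a tree theorem) and the `L²` linear response of the density (the record's
  A4), the fixed-`N` half of the crux IS uniform integrability of the odd log-ratio at scale `δ²`;
  ★ `snapshotKLUpperExpansion_of_linearResponseL2_of_momentDecay`: `K_fix ⟸ A0 ∧ A4 ∧ M_{m,a}`
  (three atoms, `m ≥ 1`, `a > 2`; e.g. `ψ_δ = O(δ)` in `L³(μ_δ)`).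

No new objects. [folklore]
-/

noncomputable section

namespace Summit.AtomisticToContinuum.FouriersLaw.Theorems.ExtensiveSnapshotIrreversibility.EnergyWindow

open MeasureTheory Filter Topology InformationTheory Real
open scoped ENNReal NNReal
open Literature.MathematicalPhysics.KineticTheory.HeatConduction
open Summit.AtomisticToContinuum.FouriersLaw.Theorems.ExtensiveSnapshotIrreversibility.Negative
open Summit.AtomisticToContinuum.FouriersLaw.Theorems.ExtensiveSnapshotIrreversibility.ClausiusBudget.OddLogDensity

variable {N : ℕ}

/-! ## 1. The graded rung atom: moment decay `(m, a)` -/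

/-- **M_{m,a} `NessOddLogRatioMomentDecay m a` (moment decay of the odd log-ratio)**: along every
steady-state family of the pinned chain (under weak-NESS uniqueness), for `T > 0`, `N ≥ 2`, there
are `δ₀ > 0` and `C` such that for `0 < |δ| < δ₀` and EVERY measurable `φ` with
`μ_{N,T+δ/2,T−δ/2} = μ_T · e^{φ}`: `|φ − φ∘Θ|ᵐ ∈ L¹(μ_δ)` and `∫ |φ − φ∘Θ|ᵐ dμ_δ ≤ C |δ|ᵃ`.
Grading: `a = m` is linear size (`ψ_δ = O(δ)` in `Lᵐ`); `a ≤ 0` is A2ₘ's regime; `a > 2`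
(with `m ≥ 1`) feeds USharp. [route statement · this cell; NOT a literature fact] -/
def NessOddLogRatioMomentDecay (m a : ℝ) : Prop :=
  ∀ ω₂ lam β γ : ℝ, 0 < ω₂ → 0 < lam → 0 < β → 0 < γ →
    (∀ (N : ℕ) (T_L T_R : ℝ), 0 < T_L → 0 < T_R → ∀ μ ν : Measure (PhaseSpace N),
      (pinnedChain ω₂ lam β γ).IsSteadyState N T_L T_R μ →
      (pinnedChain ω₂ lam β γ).IsSteadyState N T_L T_R ν → μ = ν) →
    ∀ μ : (N : ℕ) → ℝ → ℝ → Measure (PhaseSpace N),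
      (∀ (N : ℕ) (T_L T_R : ℝ), 0 < T_L → 0 < T_R →
        (pinnedChain ω₂ lam β γ).IsSteadyState N T_L T_R (μ N T_L T_R)) →
      ∀ T : ℝ, 0 < T → ∀ N : ℕ, 2 ≤ N →
        ∃ δ₀ C : ℝ, 0 < δ₀ ∧
          ∀ δ : ℝ, δ ≠ 0 → |δ| < δ₀ →
            ∀ φ : PhaseSpace N → ℝ, Measurable φ →
              μ N (T + δ / 2) (T - δ / 2) =
                ((pinnedChain ω₂ lam β γ).gibbsMeasure N T).withDensity
                  (fun x => ENNReal.ofReal (Real.exp (φ x))) →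
              Integrable (fun x => |φ x - φ (x.1, -x.2)| ^ m) (μ N (T + δ / 2) (T - δ / 2)) ∧
                ∫ x, |φ x - φ (x.1, -x.2)| ^ m ∂(μ N (T + δ / 2) (T - δ / 2)) ≤ C * |δ| ^ a

/-- **M_{m,a} refines the A2 slot**: `NessOddLogRatioMomentDecay m a ⟹ NessOddLogRatioMoment m`
(exponent `r = −a`). [folklore] -/
theorem nessOddLogRatioMoment_of_momentDecay {m a : ℝ} (hM : NessOddLogRatioMomentDecay m a) :
    NessOddLogRatioMoment m := by
  intro ω₂ lam β γ hω₂ hlam hβ hγ hU μ hμ T hT N hN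
  obtain ⟨δ₀, C, hδ₀, h⟩ := hM ω₂ lam β γ hω₂ hlam hβ hγ hU μ hμ T hT N hN
  refine ⟨δ₀, C, -a, hδ₀, fun δ hδ hδ' φ hφm hrep => ?_⟩
  rw [neg_neg]
  exact h δ hδ hδ' φ hφm hrep

/-! ## 2. The rungs into USharp -/

/-- ★ **RUNG `M_{m,a} ⟹ USharp` for `m ≥ 1`, `a > 2`.**  At a representing `φ` the state is the
tilt `μ_T.tilted φ` (`tilted_of_withDensity_exp`), the moment bound is
`∫ |ψ|ᵐ e^{φ} dμ_T ≤ C |δ|ᵃ`, and `setIntegral_abs_mul_exp_le_of_rpow_moment` applies once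
`C⁺ |δ|^{a−2} ≤ η^{m−1} ε` (`eventually_mul_rpow_abs_lt`).  No A0. [folklore] -/
theorem nessOddLogRatioUniformlyIntegrable_of_momentDecay {m a : ℝ} (hm : 1 ≤ m) (ha : 2 < a)
    (hM : NessOddLogRatioMomentDecay m a) : NessOddLogRatioUniformlyIntegrable := by
  intro ω₂ lam β γ hω₂ hlam hβ hγ hU μ hμ T hT N hN h hh η hη ε hε
  obtain ⟨δ₀, C, hδ₀, hMδ⟩ := hM ω₂ lam β γ hω₂ hlam hβ hγ hU μ hμ T hT N hN
  set P := pinnedChain ω₂ lam β γ with hP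
  set μT := P.gibbsMeasure N T with hμT
  haveI hprob : IsProbabilityMeasure μT :=
    pinnedChain_isProbabilityMeasure_gibbsMeasure hω₂ hlam.le hβ.le γ N hT
  have hsmall : ∀ᶠ δ in 𝓝[≠] (0 : ℝ), max C 0 * |δ| ^ (a - 2) < η ^ (m - 1) * ε :=
    eventually_mul_rpow_abs_lt (by linarith) (mul_pos (Real.rpow_pos_of_pos hη _) hε) _
  filter_upwards [eventually_ne_and_abs_lt hδ₀, hsmall, eventually_bath_temps_pos hT] with δ hδ hsm
    hδT φ hφm hrep
  haveI : IsProbabilityMeasure (μ N (T + δ / 2) (T - δ / 2)) := (hμ N _ _ hδT.1 hδT.2).1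
  obtain ⟨hi, hz1, htilt⟩ := tilted_of_withDensity_exp hφm hrep
  obtain ⟨hI, hle⟩ := hMδ δ hδ.1 hδ.2 φ hφm hrep
  rw [htilt] at hI hle
  rw [integrable_tilted_iff hi] at hI
  rw [integral_tilted] at hle
  have hI' : Integrable (fun x => |φ x - φ (x.1, -x.2)| ^ m * exp (φ x)) μT := by
    refine hI.congr (ae_of_all _ fun x => ?_)
    simp only [smul_eq_mul]
    ring
  have hle' : ∫ x, |φ x - φ (x.1, -x.2)| ^ m * exp (φ x) ∂μT ≤ C * |δ| ^ a := by
    refine le_trans (le_of_eq (integral_congr_ae (ae_of_all _ fun x => ?_))) hle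
    simp only [hz1, div_one, smul_eq_mul]
    ring
  exact setIntegral_abs_mul_exp_le_of_rpow_moment μT hm hη hδ.1 hsm.le hφm hi ⟨hI', hle'⟩

/-- ★ **RUNG `A2ₚ ∧ SPC ⟹ USharp` (`p > 1`)** — generation 89's tail pair feeds the one tail atom.
At a representing `φ`: the moment clause of A2ₚ and the level-set mass of SPC (as
`∫_{|ψ|>η} e^{φ} dμ_T`, `setIntegral_exp_eq_toReal_tilted`) at order `s = (r⁺+3)q/p + 3` are the
inputs of `setIntegral_abs_mul_exp_le_of_moment_of_concentration`, once `|δ| < 1` and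
`(C₂⁺/p + 1/q) |δ| ≤ ε` (`eventually_mul_abs_lt`).  No A0. [folklore] -/
theorem nessOddLogRatioUniformlyIntegrable_of_moment_of_concentration {p : ℝ} (hp : 1 < p)
    (h2 : NessOddLogRatioMoment p) (hc : NessOddLogRatioConcentration) :
    NessOddLogRatioUniformlyIntegrable := by
  intro ω₂ lam β γ hω₂ hlam hβ hγ hU μ hμ T hT N hN h hh η hη ε hε
  obtain ⟨δ₂, C₂, r, hδ₂, hT2⟩ := h2 ω₂ lam β γ hω₂ hlam hβ hγ hU μ hμ T hT N hN
  have hcT := hc ω₂ lam β γ hω₂ hlam hβ hγ hU μ hμ T hT N hN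
  set P := pinnedChain ω₂ lam β γ with hP
  set μT := P.gibbsMeasure N T with hμT
  haveI hprob : IsProbabilityMeasure μT :=
    pinnedChain_isProbabilityMeasure_gibbsMeasure hω₂ hlam.le hβ.le γ N hT
  have hpq : p.HolderConjugate (conjExponent p) := Real.HolderConjugate.conjExponent hp
  obtain ⟨δc, hδc, hcδ⟩ := hcT η hη ((max r 0 + 3) * conjExponent p / p + 3)
  have hsmall : ∀ᶠ δ in 𝓝[≠] (0 : ℝ), (max C₂ 0 / p + 1 / conjExponent p) * |δ| < ε :=
    eventually_mul_abs_lt hε _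
  have hmin : 0 < min (min δ₂ δc) 1 := lt_min (lt_min hδ₂ hδc) one_pos
  filter_upwards [eventually_ne_and_abs_lt hmin, hsmall, eventually_bath_temps_pos hT] with δ hδ
    hsm hδT φ hφm hrep
  have hδ₂' : |δ| < δ₂ := hδ.2.trans_le ((min_le_left _ _).trans (min_le_left _ _))
  have hδc' : |δ| < δc := hδ.2.trans_le ((min_le_left _ _).trans (min_le_right _ _))
  have hδ1 : |δ| < 1 := hδ.2.trans_le (min_le_right _ _)
  haveI : IsProbabilityMeasure (μ N (T + δ / 2) (T - δ / 2)) := (hμ N _ _ hδT.1 hδT.2).1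
  obtain ⟨hi, hz1, htilt⟩ := tilted_of_withDensity_exp hφm hrep
  -- (T2ₚ) at this `φ`
  obtain ⟨hI, hle⟩ := hT2 δ hδ.1 hδ₂' φ hφm hrep
  rw [htilt] at hI hle
  rw [integrable_tilted_iff hi] at hI
  rw [integral_tilted] at hle
  have hI' : Integrable (fun x => |φ x - φ (x.1, -x.2)| ^ p * exp (φ x)) μT := by
    refine hI.congr (ae_of_all _ fun x => ?_)
    simp only [smul_eq_mul]
    ring
  have hle' : ∫ x, |φ x - φ (x.1, -x.2)| ^ p * exp (φ x) ∂μT ≤ C₂ * |δ| ^ (-r) := by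
    refine le_trans (le_of_eq (integral_congr_ae (ae_of_all _ fun x => ?_))) hle
    simp only [hz1, div_one, smul_eq_mul]
    ring
  -- (SPC) at this `φ`, as a `μ_T`-integral of `e^{φ}` over the level set
  have hmass := hcδ δ hδ.1 hδc' φ hφm hrep
  rw [htilt] at hmass
  have hA : MeasurableSet {x : PhaseSpace N | η < |φ x - φ (x.1, -x.2)|} :=
    measurableSet_lt measurable_const ((hφm.sub (hφm.comp measurable_flip)).abs)
  have hS' : ∫ x in {x | η < |φ x - φ (x.1, -x.2)|}, exp (φ x) ∂μT ≤
      |δ| ^ ((max r 0 + 3) * conjExponent p / p + 3) := by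
    rw [setIntegral_exp_eq_toReal_tilted μT hi hz1 hA]
    have h' := ENNReal.toReal_mono ENNReal.ofReal_ne_top hmass
    rwa [ENNReal.toReal_ofReal (Real.rpow_nonneg (abs_nonneg δ) _)] at h'
  exact setIntegral_abs_mul_exp_le_of_moment_of_concentration μT hpq hδ.1 hδ1 hsm.le hφm hi
    ⟨hI', hle'⟩ hS'

/-! ## 3. Junctions of record -/

/-- ★ **`K_fix ⟸ A0 ∧ ΔSharp ∧ M_{m,a}`** (`m ≥ 1`, `a > 2`; e.g. linear `L³` size `m = a = 3`).
[folklore] -/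
theorem snapshotKLUpperExpansion_of_momentDecay {m a : ℝ} (hm : 1 ≤ m) (ha : 2 < a)
    (h0 : NessGibbsReweighting) (hM : NessOddLogRatioMomentDecay m a)
    (hΔ : NessFlipTriangularSharp) : SnapshotKLUpperExpansion :=
  snapshotKLUpperExpansion_of_uniformlyIntegrable h0
    (nessOddLogRatioUniformlyIntegrable_of_momentDecay hm ha hM) hΔ

/-- **Generation 89's junction `K_fix ⟸ A0 ∧ A2ₚ ∧ SPC ∧ ΔSharp` (`p > 1`), recovered THROUGH
USharp.** [folklore] -/
theorem snapshotKLUpperExpansion_of_concentration' {p : ℝ} (hp : 1 < p) (h0 : NessGibbsReweighting)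
    (h2 : NessOddLogRatioMoment p) (hc : NessOddLogRatioConcentration)
    (hΔ : NessFlipTriangularSharp) : SnapshotKLUpperExpansion :=
  snapshotKLUpperExpansion_of_uniformlyIntegrable h0
    (nessOddLogRatioUniformlyIntegrable_of_moment_of_concentration hp h2 hc) hΔ

/-- ★★ **`A0 ∧ A4 ⊢ (K_fix ⟺ USharp)`.**  With the Gibbs reweighting and the `L²` linear
response of the density (generation 89: `A0 ∧ A4 ⟹ ΔSharp`,
`nessFlipTriangularSharp_of_linearResponseL2`), the fixed-`N` half of the crux is EQUIVALENT to
uniform integrability of the odd log-ratio at scale `δ²`. [folklore] -/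
theorem snapshotKLUpperExpansion_iff_uniformlyIntegrable (h0 : NessGibbsReweighting)
    (h4 : NessLinearResponseL2) :
    SnapshotKLUpperExpansion ↔ NessOddLogRatioUniformlyIntegrable :=
  ⟨nessOddLogRatioUniformlyIntegrable_of_snapshotKLUpperExpansion, fun hu =>
    snapshotKLUpperExpansion_of_uniformlyIntegrable h0 hu
      (nessFlipTriangularSharp_of_linearResponseL2 h0 h4)⟩

/-- ★ **`K_fix ⟸ A0 ∧ A4 ∧ M_{m,a}`** (`m ≥ 1`, `a > 2`): three atoms — reweighting, `L²` linear
response, and a moment of the odd log-ratio decaying faster than `δ²`. [folklore] -/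
theorem snapshotKLUpperExpansion_of_linearResponseL2_of_momentDecay {m a : ℝ} (hm : 1 ≤ m)
    (ha : 2 < a) (h0 : NessGibbsReweighting) (h4 : NessLinearResponseL2)
    (hM : NessOddLogRatioMomentDecay m a) : SnapshotKLUpperExpansion :=
  (snapshotKLUpperExpansion_iff_uniformlyIntegrable h0 h4).2
    (nessOddLogRatioUniformlyIntegrable_of_momentDecay hm ha hM)

/-- **`K_fix ⟸ A0 ∧ A4 ∧ A2ₚ ∧ SPC`** (`p > 1`) — generation 89's ladder junction of record, now a
one-line corollary of the `iff`. [folklore] -/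
theorem snapshotKLUpperExpansion_of_linearResponseL2_of_concentration {p : ℝ} (hp : 1 < p)
    (h0 : NessGibbsReweighting) (h4 : NessLinearResponseL2) (h2 : NessOddLogRatioMoment p)
    (hc : NessOddLogRatioConcentration) : SnapshotKLUpperExpansion :=
  (snapshotKLUpperExpansion_iff_uniformlyIntegrable h0 h4).2
    (nessOddLogRatioUniformlyIntegrable_of_moment_of_concentration hp h2 hc)

end Summit.AtomisticToContinuum.FouriersLaw.Theorems.ExtensiveSnapshotIrreversibility.EnergyWindow

end
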